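import Literature.MathematicalPhysics.QuantumLattice.AnisotropicHeisenbergThermalEnergyComparison
import HarnessLib

/-!
# Kennedy–Lieb–Shastry's remark for the layered spin-`½` antiferromagnet at positive temperature,
# in certificate form: Néel order at inverse temperature `β` from certified values of the
# integrals (6)–(9) and of Fröhlich–Israel–Lieb–Simon's constant `C(r)`

Topic `MathematicalPhysics/QuantumLattice`; assembles
`AnisotropicHeisenbergThermalTwoSumRule.lean` (the two-sum-rule bound at `T > 0`),
`AnisotropicHeisenbergThermalEnergyComparison.lean` (`0 ≤ ρ₃ ≤ ρ₁` at `T > 0`) and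
`AnisotropicHeisenbergThermalNeelOrder.lean` (sums to integrals) into the positive-temperature
analogues of the ground-state certificate theorems of `AnisotropicHeisenbergTwoSumRule.lean` /
`AnisotropicHeisenbergNeelOrder.lean`. No named fact is introduced; nothing numerical is asserted.

## What is printed

[KLS1988JSP] p. 1020: "For this model we prove that there is Néel order if `1 ≥ r ≥ 0.16`.
(Although we only consider the ground states of these models, the techniques we use may be combined
with the techniques of Dyson et al. for nonzero temperatures to prove the existence of a phase
transition for `1 ≥ r ≥ 0.16`.)"  The ground-state proof (p. 1023) evaluates the linear programme
(6)–(9) numerically for `e₀` "ranging from the Néel bound of `(2+r)/4` to the Anderson bound";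
at `T > 0` the techniques of [DLS1978] add the term `(2βE^r_{q-Q})⁻¹` to the infrared bound (6)
(Thm. 6.1), whose momentum average is the constant `C(r) = (2π)⁻³∫d³q/E^r_q` ([FILS1978] (4.7)),
and replace the Néel bound by the energy–entropy bound (the constant `D` of [DLS1978] §6).

## What is proved (every `d ≥ 3` for the integral forms, every spin `S = n/2`, every `K > 0`, `β > 0`)

* **`heisAniso_thermal_neelOrder_of_dirCertificate`**, `heisAniso_thermal_neelLRO_of_dirCertificate`,
  `heisAniso_thermal_neelLRO_of_integral_dirCertificate` — Néel order at inverse temperature `β`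
  from finitely many `(tⱼ, μⱼ, W̄ⱼ, T̄ⱼ)` (`tⱼ - Σᵢμⱼᵢ > 0`, `𝓘^K_{tⱼ,μⱼ} < W̄ⱼ`,
  `({tⱼ}₊ + Σᵢ|μⱼᵢ|)C₀(K) < T̄ⱼ`) and a real-arithmetic certificate with margin `δ` over the a-priori
  region of the unknowns `(εᵢ(β))`: (Pᵀ) `εᵢ ≤ 0`, (Xᵀ) `ε_{i₀} ≤ εᵢ`, (Sᵀ) `Kᵢ = K_{i₀} ⇒ εᵢ = ε_{i₀}`,
  (Nᵀ) `ΣKᵢεᵢ ≤ -(S²/3)ΣKᵢ + log(n+1)/(3β)`, (T) `-S² ≤ εᵢ`, each admitting `j` with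
  `δ(tⱼ - Σᵢμⱼᵢ) ≤ tⱼS(S+1)/3 + Σᵢμⱼᵢεᵢ - (-ε_{i₀}/2)^{1/2}W̄ⱼ - T̄ⱼ/(2β)`;
* **`heisAniso_thermal_neelLRO_of_klsCertificate`** — the printed one-parameter form (`μ = λK`,
  `f² = eE/2κ_TE'`): certificate over the energy window
  `[(S²/3)ΣK - log(n+1)/(3β), S²ΣK]`;
* **`layeredHeis_neelLRO_thermal_of_certificate`** — `K = (1, 1, r)`, `0 < r ≤ 1`: Néel long-range
  order of the Gibbs states on the even tori `(ℤ/(2k+2)ℤ)³` at inverse temperature `β` from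
  certified bounds `W̄ⱼ > 𝓘^{(1,1,r)}_{tⱼ,λⱼ(1,1,r)}`, `T̄ⱼ > ({tⱼ}₊ + |λⱼ|(2+r))·C(r)`
  (`C(r) = klsConstant r ≤ 3 + log(1/r)`) and a certificate on the window
  `[(2+r)S²/3 - log(n+1)/(3β), (2+r)S²]` with `(e/4)^{1/2}` — exactly the computation KLS announce
  for `S = ½`, `1 ≥ r ≥ 0.16`, `β` large, with its numerical step as the explicit input;
  **`layeredHeis_neelLRO_thermal_spinHalf_of_certificate`** spells out `S = ½`: window
  `(2+r)/12 - log 2/(3β) ≤ e ≤ (2+r)/4`, certificate `δ(tⱼ - λⱼ(2+r)) ≤ tⱼ/4 - λⱼe - (e/4)^{1/2}W̄ⱼ - T̄ⱼ/(2β)`.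

## References

* [KLS1988JSP] T. Kennedy, E. H. Lieb, B. S. Shastry, J. Stat. Phys. 53 (1988) 1019–1030, p. 1020,
  §3, eqs. (5)–(9), pp. 1023, 1026.
* [DLS1978] F. J. Dyson, E. H. Lieb, B. Simon, J. Stat. Phys. 18 (1978) 335–383, Thms. 5.1, 6.1, 6.2,
  §6.
* [FILS1978] J. Fröhlich, R. Israel, E. H. Lieb, B. Simon, Commun. Math. Phys. 62 (1978) 1–34, (4.7).
-/

noncomputable section

open Filter Topology Matrix Finset
open Literature.MathematicalPhysics.QuantumLattice Literature.Probability.LatticeModels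

namespace Literature.MathematicalPhysics.QuantumLattice

variable {d : ℕ}

/-! ### Direction-resolved multipliers -/

section DirCertificate

/-- **Néel order at inverse temperature `β` from a certificate, direction-resolved multipliers**
(one multiplier per sum rule (2), (3ᵢ)). Data: `K > 0` with a largest coupling `K_{i₀}`, spin
`S = n/2`, `β > 0`, finitely many `(tⱼ, μⱼ, W̄ⱼ, T̄ⱼ)` with `tⱼ - Σᵢμⱼᵢ > 0` and, along the even sides,
eventually `𝓦^K_{tⱼ,μⱼ}(2k) ≤ W̄ⱼ`, `𝓣^K_{tⱼ,μⱼ}(2k) ≤ T̄ⱼ`; and a margin `δ` such that EVERY vector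
`ε` of the a-priori region — (Pᵀ) `εᵢ ≤ 0`, (Xᵀ) `ε_{i₀} ≤ εᵢ`, (Sᵀ) `Kᵢ = K_{i₀} ⇒ εᵢ = ε_{i₀}`,
(Nᵀ) `ΣKᵢεᵢ ≤ -(S²/3)ΣKᵢ + log(n+1)/(3β)`, (T) `-S² ≤ εᵢ` — admits `j ∈ J` with
`δ(tⱼ - Σᵢμⱼᵢ) ≤ tⱼS(S+1)/3 + Σᵢμⱼᵢεᵢ - (-ε_{i₀}/2)^{1/2}W̄ⱼ - T̄ⱼ/(2β)`. Then eventually (along the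
sides `2k + 2`) `|Λ|⁻¹ĝ_Q(β) ≥ δ`. (For `K = (1,1,r)` the region is the polygon
`0 ≤ ρ₃ ≤ ρ₁ ≤ 3S²`, `2ρ₁ + rρ₃ ≥ (2+r)S² - log(n+1)/β` of KLS's unknowns `ρ₁ = ρ₂`, `ρ₃`, at `T > 0`.)
[cite: KLS1988JSP, p. 1020, eqs. (5)-(9), pp. 1023, 1026] [cite: DLS1978, Thms. 6.1, 6.2, §6] -/
theorem heisAniso_thermal_neelOrder_of_dirCertificate {n : ℕ} {K : Fin d → ℝ} (hK : ∀ i, 0 < K i)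
    {β : ℝ} (hβ : 0 < β) {i₀ : Fin d} (hmax : ∀ i, K i ≤ K i₀) {ι : Type*} (J : Finset ι)
    (t : ι → ℝ) (μ : ι → Fin d → ℝ) (Wbar Tbar : ι → ℝ) (hpos : ∀ j ∈ J, 0 < t j - ∑ i, μ j i)
    (hW : ∀ j ∈ J, ∀ᶠ k : ℕ in atTop, heisAnisoKlsRiemannSum K (t j) (μ j) (2 * k) ≤ Wbar j)
    (hT : ∀ j ∈ J, ∀ᶠ k : ℕ in atTop, heisAnisoThermalRiemannSum K (t j) (μ j) (2 * k) ≤ Tbar j)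
    {δ : ℝ}
    (hcert : ∀ ε : Fin d → ℝ, (∀ i, ε i ≤ 0) → (∀ i, ε i₀ ≤ ε i) →
      (∀ i, K i = K i₀ → ε i = ε i₀) →
      (∑ i, K i * ε i ≤ -(((n : ℝ) / 2) ^ 2 / 3) * ∑ i, K i + Real.log (n + 1) / (3 * β)) →
      (∀ i, -((n : ℝ) / 2) ^ 2 ≤ ε i) →
      ∃ j ∈ J, δ * (t j - ∑ i, μ j i) ≤
        t j * ((n : ℝ) / 2 * ((n : ℝ) / 2 + 1) / 3) + ∑ i, μ j i * ε i -
          Real.sqrt (-ε i₀ / 2) * Wbar j - 1 / (2 * β) * Tbar j) :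
    ∀ᶠ k : ℕ in atTop,
      δ ≤ gibbsStructureFactor β (heisAnisoTorus (2 * k + 2) n K) 0 (neelIndex (2 * k + 2)) /
        ((2 * k + 2 : ℕ) : ℝ) ^ d := by
  have hall : ∀ᶠ k : ℕ in atTop, ∀ j ∈ J,
      heisAnisoKlsRiemannSum K (t j) (μ j) (2 * k) ≤ Wbar j ∧
        heisAnisoThermalRiemannSum K (t j) (μ j) (2 * k) ≤ Tbar j :=
    (J.eventually_all).2 fun j hj => (hW j hj).and (hT j hj)
  have h2k : Tendsto (fun k : ℕ => k + 1) atTop atTop :=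
    tendsto_atTop_atTop.2 fun b => ⟨b, fun k hk => by omega⟩
  filter_upwards [h2k.eventually hall, eventually_ge_atTop 1] with k hk hk1
  haveI : NeZero (2 * (k + 1)) := ⟨by omega⟩
  have hk2 : 2 ≤ k + 1 := by omega
  have hL3 : 3 ≤ 2 * (k + 1) := by omega
  show δ ≤ gibbsStructureFactor β (heisAnisoTorus (2 * (k + 1)) n K) 0 (neelIndex (2 * (k + 1))) /
      ((2 * (k + 1) : ℕ) : ℝ) ^ d
  set ε : Fin d → ℝ := fun i => gibbsDirBondCorr β (heisAnisoTorus (2 * (k + 1)) n K) 0 i with hε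
  have hP : ∀ i, ε i ≤ 0 := fun i => gibbsDirBondCorr_anisoHeis_nonpos (k + 1) n hL3 hβ (hK i)
  have hX : ∀ i, ε i₀ ≤ ε i := fun i =>
    gibbsDirBondCorr_anisoHeis_le_of_coupling_le (2 * (k + 1)) n hL3 K hβ (hmax i)
  have hS : ∀ i, K i = K i₀ → ε i = ε i₀ := fun i hi =>
    gibbsDirBondCorr_anisoHeis_eq_of_coupling_eq (2 * (k + 1)) n hL3 K β 0 hi
  have hN : ∑ i, K i * ε i ≤ -(((n : ℝ) / 2) ^ 2 / 3) * ∑ i, K i + Real.log (n + 1) / (3 * β) :=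
    heisAniso_thermal_neelBound (k + 1) n hL3 K hβ
  have hTb : ∀ i, -((n : ℝ) / 2) ^ 2 ≤ ε i := fun i => by
    have h := abs_gibbsDirBondCorr_le β (heisAnisoTorus_isHermitian (2 * (k + 1)) n K) 0 i
    rw [abs_le] at h
    exact h.1
  obtain ⟨j, hj, hcj⟩ := hcert ε hP hX hS hN hTb
  have hmain := heisAniso_twoSumRule_thermal_max (k + 1) n hk2 hK hβ hmax (t j) (μ j)
  obtain ⟨hWk, hTk⟩ := hk j hj
  have hsq : 0 ≤ Real.sqrt (-ε i₀ / 2) := Real.sqrt_nonneg _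
  have hβ' : 0 ≤ 1 / (2 * β) := by positivity
  have h1 : t j * ((n : ℝ) / 2 * ((n : ℝ) / 2 + 1) / 3) + ∑ i, μ j i * ε i -
        Real.sqrt (-ε i₀ / 2) * Wbar j - 1 / (2 * β) * Tbar j ≤
      t j * ((n : ℝ) / 2 * ((n : ℝ) / 2 + 1) / 3) + ∑ i, μ j i * ε i -
        Real.sqrt (-ε i₀ / 2) * heisAnisoKlsRiemannSum K (t j) (μ j) (2 * (k + 1)) -
        1 / (2 * β) * heisAnisoThermalRiemannSum K (t j) (μ j) (2 * (k + 1)) := by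
    nlinarith [mul_le_mul_of_nonneg_left hWk hsq, mul_le_mul_of_nonneg_left hTk hβ']
  have h2 := (hcj.trans h1).trans hmain
  exact le_of_mul_le_mul_left (by linarith [h2]) (hpos j hj)

/-- **Néel long-range order at inverse temperature `β` from a direction-resolved certificate**, as a
`liminf`: under the hypotheses of `heisAniso_thermal_neelOrder_of_dirCertificate`,
`liminf_k |Λ_k|⁻² Σ_{x,y} (-1)^{x+y} ⟨𝐒_x·𝐒_y⟩_β ≥ 3δ` along the even tori `(ℤ/(2k+2)ℤ)^d`.
[cite: KLS1988JSP, p. 1020, eqs. (5)-(9), p. 1023] [cite: DLS1978, Thm. 6.2] -/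
theorem heisAniso_thermal_neelLRO_of_dirCertificate {n : ℕ} {K : Fin d → ℝ} (hK : ∀ i, 0 < K i)
    {β : ℝ} (hβ : 0 < β) {i₀ : Fin d} (hmax : ∀ i, K i ≤ K i₀) {ι : Type*} (J : Finset ι)
    (t : ι → ℝ) (μ : ι → Fin d → ℝ) (Wbar Tbar : ι → ℝ) (hpos : ∀ j ∈ J, 0 < t j - ∑ i, μ j i)
    (hW : ∀ j ∈ J, ∀ᶠ k : ℕ in atTop, heisAnisoKlsRiemannSum K (t j) (μ j) (2 * k) ≤ Wbar j)
    (hT : ∀ j ∈ J, ∀ᶠ k : ℕ in atTop, heisAnisoThermalRiemannSum K (t j) (μ j) (2 * k) ≤ Tbar j)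
    {δ : ℝ}
    (hcert : ∀ ε : Fin d → ℝ, (∀ i, ε i ≤ 0) → (∀ i, ε i₀ ≤ ε i) →
      (∀ i, K i = K i₀ → ε i = ε i₀) →
      (∑ i, K i * ε i ≤ -(((n : ℝ) / 2) ^ 2 / 3) * ∑ i, K i + Real.log (n + 1) / (3 * β)) →
      (∀ i, -((n : ℝ) / 2) ^ 2 ≤ ε i) →
      ∃ j ∈ J, δ * (t j - ∑ i, μ j i) ≤
        t j * ((n : ℝ) / 2 * ((n : ℝ) / 2 + 1) / 3) + ∑ i, μ j i * ε i -
          Real.sqrt (-ε i₀ / 2) * Wbar j - 1 / (2 * β) * Tbar j) :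
    3 * δ ≤ liminf (fun k : ℕ =>
      (∑ x : TorusSite d (2 * k + 2), ∑ y : TorusSite d (2 * k + 2),
        (-1 : ℝ) ^ (∑ i, (x i).val) * (-1) ^ (∑ i, (y i).val) *
          ∑ α : Fin 3, gibbsSpinCorr β (heisAnisoTorus (2 * k + 2) n K) α x y) /
        ((2 * k + 2 : ℕ) : ℝ) ^ (2 * d)) atTop := by
  have hev := heisAniso_thermal_neelOrder_of_dirCertificate hK hβ hmax J t μ Wbar Tbar hpos hW hT hcert
  refine le_liminf_of_le ?_ ?_
  · exact isCoboundedUnder_ge_of_le atTop fun k => by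
      haveI : NeZero (2 * k + 2) := ⟨by omega⟩
      exact heisAniso_thermal_neelSum_le n (2 * k + 2) K β
  · filter_upwards [hev] with k hk
    haveI : NeZero (2 * (k + 1)) := ⟨by omega⟩
    show 3 * δ ≤ (∑ x : TorusSite d (2 * (k + 1)), ∑ y : TorusSite d (2 * (k + 1)),
        (-1 : ℝ) ^ (∑ i, (x i).val) * (-1) ^ (∑ i, (y i).val) *
          ∑ α : Fin 3, gibbsSpinCorr β (heisAnisoTorus (2 * (k + 1)) n K) α x y) /
        ((2 * (k + 1) : ℕ) : ℝ) ^ (2 * d)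
    rw [heisAniso_thermal_neelSum_eq n (k + 1) K β]
    have hk' : δ ≤ gibbsStructureFactor β (heisAnisoTorus (2 * (k + 1)) n K) 0
        (neelIndex (2 * (k + 1))) / ((2 * (k + 1) : ℕ) : ℝ) ^ d := hk
    linarith

/-- **Néel long-range order at inverse temperature `β` from certified integrals, direction-resolved
multipliers** (`d ≥ 3`): the `liminf` statement of `heisAniso_thermal_neelLRO_of_dirCertificate`
with the eventual Riemann-sum bounds replaced by `𝓘^K_{tⱼ,μⱼ} < W̄ⱼ` and
`({tⱼ}₊ + Σᵢ|μⱼᵢ|)·C₀(K) < T̄ⱼ`. [cite: KLS1988JSP, p. 1020, eqs. (5)-(9), p. 1023]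
[cite: DLS1978, Thms. 5.1, 6.2] [cite: FILS1978, eq. (4.7)] -/
theorem heisAniso_thermal_neelLRO_of_integral_dirCertificate (hd3 : 3 ≤ d) {n : ℕ} {K : Fin d → ℝ}
    (hK : ∀ i, 0 < K i) {β : ℝ} (hβ : 0 < β) {i₀ : Fin d} (hmax : ∀ i, K i ≤ K i₀) {ι : Type*}
    (J : Finset ι) (t : ι → ℝ) (μ : ι → Fin d → ℝ) (Wbar Tbar : ι → ℝ)
    (hpos : ∀ j ∈ J, 0 < t j - ∑ i, μ j i)
    (hI : ∀ j ∈ J, heisAnisoKlsIntegral K (t j) (μ j) < Wbar j)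
    (hC : ∀ j ∈ J, (max (t j) 0 + ∑ i, |μ j i|) * AnisotropicRotator.infraredConstant K < Tbar j)
    {δ : ℝ}
    (hcert : ∀ ε : Fin d → ℝ, (∀ i, ε i ≤ 0) → (∀ i, ε i₀ ≤ ε i) →
      (∀ i, K i = K i₀ → ε i = ε i₀) →
      (∑ i, K i * ε i ≤ -(((n : ℝ) / 2) ^ 2 / 3) * ∑ i, K i + Real.log (n + 1) / (3 * β)) →
      (∀ i, -((n : ℝ) / 2) ^ 2 ≤ ε i) →
      ∃ j ∈ J, δ * (t j - ∑ i, μ j i) ≤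
        t j * ((n : ℝ) / 2 * ((n : ℝ) / 2 + 1) / 3) + ∑ i, μ j i * ε i -
          Real.sqrt (-ε i₀ / 2) * Wbar j - 1 / (2 * β) * Tbar j) :
    3 * δ ≤ liminf (fun k : ℕ =>
      (∑ x : TorusSite d (2 * k + 2), ∑ y : TorusSite d (2 * k + 2),
        (-1 : ℝ) ^ (∑ i, (x i).val) * (-1) ^ (∑ i, (y i).val) *
          ∑ α : Fin 3, gibbsSpinCorr β (heisAnisoTorus (2 * k + 2) n K) α x y) /
        ((2 * k + 2 : ℕ) : ℝ) ^ (2 * d)) atTop :=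
  heisAniso_thermal_neelLRO_of_dirCertificate hK hβ hmax J t μ Wbar Tbar hpos
    (fun j hj => heisAnisoKlsRiemannSum_eventually_le hd3 hK (t j) (μ j) (hI j hj))
    (fun j hj => heisAnisoThermalRiemannSum_eventually_le hd3 hK (t j) (μ j) (hC j hj)) hcert

end DirCertificate

/-! ### The printed one-parameter form: the energy as the unknown -/

section KLSCertificate

/-- **Néel order at inverse temperature `β` from a certificate in Kennedy–Lieb–Shastry's
one-parameter form.** Data: `K > 0` with a largest coupling `K_{i₀}` carried by `T` (`κ_T > 0`),
spin `S = n/2`, `β > 0`, finitely many `(tⱼ, λⱼ, W̄ⱼ, T̄ⱼ)` with `tⱼ - λⱼΣK > 0` and, along the even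
sides, eventually `𝓦^K_{tⱼ,λⱼK}(2k) ≤ W̄ⱼ` and `𝓣^K_{tⱼ,λⱼK}(2k) ≤ T̄ⱼ`; and a margin `δ` such that
every energy `e` of the window `[(S²/3)ΣK - log(n+1)/(3β), S²ΣK]` admits `j` with
`δ(tⱼ - λⱼΣK) ≤ tⱼS(S+1)/3 - λⱼe - (e/2κ_T)^{1/2}W̄ⱼ - T̄ⱼ/(2β)`. Then eventually (sides `2k + 2`)
`|Λ|⁻¹ĝ_Q(β) ≥ δ`. [cite: KLS1988JSP, p. 1020, eqs. (5)-(9), p. 1023] [cite: DLS1978, Thms. 6.1, 6.2, §6] -/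
theorem heisAniso_thermal_neelOrder_of_klsCertificate {n : ℕ} {K : Fin d → ℝ} (hK : ∀ i, 0 < K i)
    {β : ℝ} (hβ : 0 < β) {i₀ : Fin d} (hmax : ∀ i, K i ≤ K i₀) (T : Finset (Fin d))
    (hT : ∀ i ∈ T, K i = K i₀) (hκ : 0 < ∑ i ∈ T, K i) {ι : Type*} (J : Finset ι)
    (t lam Wbar Tbar : ι → ℝ) (hpos : ∀ j ∈ J, 0 < t j - lam j * ∑ i, K i)
    (hW : ∀ j ∈ J, ∀ᶠ k : ℕ in atTop,
      heisAnisoKlsRiemannSum K (t j) (fun i => lam j * K i) (2 * k) ≤ Wbar j)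
    (hTh : ∀ j ∈ J, ∀ᶠ k : ℕ in atTop,
      heisAnisoThermalRiemannSum K (t j) (fun i => lam j * K i) (2 * k) ≤ Tbar j)
    {δ : ℝ}
    (hcert : ∀ e : ℝ, ((n : ℝ) / 2) ^ 2 / 3 * ∑ i, K i - Real.log (n + 1) / (3 * β) ≤ e →
      e ≤ ((n : ℝ) / 2) ^ 2 * ∑ i, K i →
      ∃ j ∈ J, δ * (t j - lam j * ∑ i, K i) ≤
        t j * ((n : ℝ) / 2 * ((n : ℝ) / 2 + 1) / 3) - lam j * e -
          Real.sqrt (e / (2 * ∑ i ∈ T, K i)) * Wbar j - 1 / (2 * β) * Tbar j) :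
    ∀ᶠ k : ℕ in atTop,
      δ ≤ gibbsStructureFactor β (heisAnisoTorus (2 * k + 2) n K) 0 (neelIndex (2 * k + 2)) /
        ((2 * k + 2 : ℕ) : ℝ) ^ d := by
  have hall : ∀ᶠ k : ℕ in atTop, ∀ j ∈ J,
      heisAnisoKlsRiemannSum K (t j) (fun i => lam j * K i) (2 * k) ≤ Wbar j ∧
        heisAnisoThermalRiemannSum K (t j) (fun i => lam j * K i) (2 * k) ≤ Tbar j :=
    (J.eventually_all).2 fun j hj => (hW j hj).and (hTh j hj)
  have h2k : Tendsto (fun k : ℕ => k + 1) atTop atTop :=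
    tendsto_atTop_atTop.2 fun b => ⟨b, fun k hk => by omega⟩
  filter_upwards [h2k.eventually hall, eventually_ge_atTop 1] with k hk hk1
  haveI : NeZero (2 * (k + 1)) := ⟨by omega⟩
  have hk2 : 2 ≤ k + 1 := by omega
  have hL3 : 3 ≤ 2 * (k + 1) := by omega
  show δ ≤ gibbsStructureFactor β (heisAnisoTorus (2 * (k + 1)) n K) 0 (neelIndex (2 * (k + 1))) /
      ((2 * (k + 1) : ℕ) : ℝ) ^ d
  set e := -∑ i, K i * gibbsDirBondCorr β (heisAnisoTorus (2 * (k + 1)) n K) 0 i with he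
  obtain ⟨hlo, hhi⟩ := heisAniso_thermal_energy_window (k + 1) n hL3 (fun i => (hK i).le) hβ
  obtain ⟨j, hj, hcj⟩ := hcert e hlo hhi
  have hmain := heisAniso_twoSumRule_thermal_kls (k + 1) n hk2 hK hβ hmax T hT hκ (t j) (lam j)
  rw [← he] at hmain
  obtain ⟨hWk, hTk⟩ := hk j hj
  have hsq : 0 ≤ Real.sqrt (e / (2 * ∑ i ∈ T, K i)) := Real.sqrt_nonneg _
  have hβ' : 0 ≤ 1 / (2 * β) := by positivity
  have h1 : t j * ((n : ℝ) / 2 * ((n : ℝ) / 2 + 1) / 3) - lam j * e -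
        Real.sqrt (e / (2 * ∑ i ∈ T, K i)) * Wbar j - 1 / (2 * β) * Tbar j ≤
      t j * ((n : ℝ) / 2 * ((n : ℝ) / 2 + 1) / 3) - lam j * e -
        Real.sqrt (e / (2 * ∑ i ∈ T, K i)) *
          heisAnisoKlsRiemannSum K (t j) (fun i => lam j * K i) (2 * (k + 1)) -
        1 / (2 * β) * heisAnisoThermalRiemannSum K (t j) (fun i => lam j * K i) (2 * (k + 1)) := by
    nlinarith [mul_le_mul_of_nonneg_left hWk hsq, mul_le_mul_of_nonneg_left hTk hβ']
  have h2 := (hcj.trans h1).trans hmain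
  exact le_of_mul_le_mul_left (by linarith [h2]) (hpos j hj)

/-- **Néel long-range order at inverse temperature `β` from certified integrals in KLS's
one-parameter form** (`d ≥ 3`): with `𝓘^K_{tⱼ,λⱼK} < W̄ⱼ`, `({tⱼ}₊ + Σᵢ|λⱼKᵢ|)·C₀(K) < T̄ⱼ` and the
certificate on the energy window `[(S²/3)ΣK - log(n+1)/(3β), S²ΣK]`,
`liminf_k |Λ_k|⁻² Σ_{x,y}(-1)^{x+y}⟨𝐒_x·𝐒_y⟩_β ≥ 3δ` along the even tori `(ℤ/(2k+2)ℤ)^d` — the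
positive-temperature phase transition of [KLS1988JSP] p. 1020 in the form that consumes a certified
evaluation of (6)–(9) and of `C₀`.
[cite: KLS1988JSP, p. 1020, eqs. (5)-(9), p. 1023] [cite: DLS1978, Thms. 5.1, 6.2] [cite: FILS1978, eq. (4.7)] -/
theorem heisAniso_thermal_neelLRO_of_klsCertificate (hd3 : 3 ≤ d) {n : ℕ} {K : Fin d → ℝ}
    (hK : ∀ i, 0 < K i) {β : ℝ} (hβ : 0 < β) {i₀ : Fin d} (hmax : ∀ i, K i ≤ K i₀)
    (T : Finset (Fin d)) (hT : ∀ i ∈ T, K i = K i₀) (hκ : 0 < ∑ i ∈ T, K i) {ι : Type*}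
    (J : Finset ι) (t lam Wbar Tbar : ι → ℝ) (hpos : ∀ j ∈ J, 0 < t j - lam j * ∑ i, K i)
    (hI : ∀ j ∈ J, heisAnisoKlsIntegral K (t j) (fun i => lam j * K i) < Wbar j)
    (hC : ∀ j ∈ J, (max (t j) 0 + ∑ i, |lam j * K i|) * AnisotropicRotator.infraredConstant K < Tbar j)
    {δ : ℝ}
    (hcert : ∀ e : ℝ, ((n : ℝ) / 2) ^ 2 / 3 * ∑ i, K i - Real.log (n + 1) / (3 * β) ≤ e →
      e ≤ ((n : ℝ) / 2) ^ 2 * ∑ i, K i →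
      ∃ j ∈ J, δ * (t j - lam j * ∑ i, K i) ≤
        t j * ((n : ℝ) / 2 * ((n : ℝ) / 2 + 1) / 3) - lam j * e -
          Real.sqrt (e / (2 * ∑ i ∈ T, K i)) * Wbar j - 1 / (2 * β) * Tbar j) :
    3 * δ ≤ liminf (fun k : ℕ =>
      (∑ x : TorusSite d (2 * k + 2), ∑ y : TorusSite d (2 * k + 2),
        (-1 : ℝ) ^ (∑ i, (x i).val) * (-1) ^ (∑ i, (y i).val) *
          ∑ α : Fin 3, gibbsSpinCorr β (heisAnisoTorus (2 * k + 2) n K) α x y) /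
        ((2 * k + 2 : ℕ) : ℝ) ^ (2 * d)) atTop := by
  have hev := heisAniso_thermal_neelOrder_of_klsCertificate hK hβ hmax T hT hκ J t lam Wbar Tbar hpos
    (fun j hj => heisAnisoKlsRiemannSum_eventually_le hd3 hK (t j) _ (hI j hj))
    (fun j hj => heisAnisoThermalRiemannSum_eventually_le hd3 hK (t j) _ (hC j hj)) hcert
  refine le_liminf_of_le ?_ ?_
  · exact isCoboundedUnder_ge_of_le atTop fun k => by
      haveI : NeZero (2 * k + 2) := ⟨by omega⟩
      exact heisAniso_thermal_neelSum_le n (2 * k + 2) K β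
  · filter_upwards [hev] with k hk
    haveI : NeZero (2 * (k + 1)) := ⟨by omega⟩
    show 3 * δ ≤ (∑ x : TorusSite d (2 * (k + 1)), ∑ y : TorusSite d (2 * (k + 1)),
        (-1 : ℝ) ^ (∑ i, (x i).val) * (-1) ^ (∑ i, (y i).val) *
          ∑ α : Fin 3, gibbsSpinCorr β (heisAnisoTorus (2 * (k + 1)) n K) α x y) /
        ((2 * (k + 1) : ℕ) : ℝ) ^ (2 * d)
    rw [heisAniso_thermal_neelSum_eq n (k + 1) K β]
    have hk' : δ ≤ gibbsStructureFactor β (heisAnisoTorus (2 * (k + 1)) n K) 0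
        (neelIndex (2 * (k + 1))) / ((2 * (k + 1) : ℕ) : ℝ) ^ d := hk
    linarith

/-- **The layered model of Kennedy–Lieb–Shastry at positive temperature** ([KLS1988JSP] eq. (5):
couplings `1, 1, r` on the cubic lattice, `0 < r ≤ 1`; p. 1020: "the techniques we use may be
combined with the techniques of Dyson et al. for nonzero temperatures to prove the existence of a
phase transition for `1 ≥ r ≥ 0.16`"), spin `S = n/2`, inverse temperature `β > 0`: Néel long-range
order of the Gibbs states on the even tori `(ℤ/(2k+2)ℤ)³` follows from finitely many certified upper
bounds `W̄ⱼ > 𝓘^{(1,1,r)}_{tⱼ,λⱼ(1,1,r)}` of the integrals of (6)–(9), `T̄ⱼ > ({tⱼ}₊ + |λⱼ|(2+r))·C(r)`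
of the Dyson–Lieb–Simon term (`C(r) = klsConstant r = (2π)⁻³∫d³q/E^r_q ≤ 3 + log(1/r)`), and a
real-arithmetic certificate on the energy window `[(2+r)S²/3 - log(n+1)/(3β), (2+r)S²]`
(`κ_T = 2`, `(e/4)^{1/2}`; for `S = ½`: `e₀/3` ranging from the Néel-minus-entropy bound).
[cite: KLS1988JSP, p. 1020, eqs. (5)-(9), p. 1023] [cite: DLS1978, Thms. 5.1, 6.2, §6] [cite: FILS1978, eq. (4.7)] -/
theorem layeredHeis_neelLRO_thermal_of_certificate {n : ℕ} {r : ℝ} (hr0 : 0 < r) (hr1 : r ≤ 1)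
    {β : ℝ} (hβ : 0 < β) {ι : Type*} (J : Finset ι) (t lam Wbar Tbar : ι → ℝ)
    (hpos : ∀ j ∈ J, 0 < t j - lam j * (2 + r))
    (hI : ∀ j ∈ J,
      heisAnisoKlsIntegral ![(1 : ℝ), 1, r] (t j) (fun i => lam j * ![(1 : ℝ), 1, r] i) < Wbar j)
    (hC : ∀ j ∈ J, (max (t j) 0 + |lam j| * (2 + r)) * AnisotropicRotator.klsConstant r < Tbar j)
    {δ : ℝ}
    (hcert : ∀ e : ℝ, ((n : ℝ) / 2) ^ 2 / 3 * (2 + r) - Real.log (n + 1) / (3 * β) ≤ e →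
      e ≤ ((n : ℝ) / 2) ^ 2 * (2 + r) →
      ∃ j ∈ J, δ * (t j - lam j * (2 + r)) ≤
        t j * ((n : ℝ) / 2 * ((n : ℝ) / 2 + 1) / 3) - lam j * e - Real.sqrt (e / 4) * Wbar j -
          1 / (2 * β) * Tbar j) :
    3 * δ ≤ liminf (fun k : ℕ =>
      (∑ x : TorusSite 3 (2 * k + 2), ∑ y : TorusSite 3 (2 * k + 2),
        (-1 : ℝ) ^ (∑ i, (x i).val) * (-1) ^ (∑ i, (y i).val) *
          ∑ α : Fin 3, gibbsSpinCorr β (heisAnisoTorus (2 * k + 2) n ![(1 : ℝ), 1, r]) α x y) /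
        ((2 * k + 2 : ℕ) : ℝ) ^ (2 * 3)) atTop := by
  set K : Fin 3 → ℝ := ![(1 : ℝ), 1, r] with hKdef
  have hK0 : K 0 = 1 := rfl
  have hK1 : K 1 = 1 := rfl
  have hK2 : K 2 = r := rfl
  have hK : ∀ i, 0 < K i := by
    intro i; fin_cases i <;> simp [hKdef, hr0]
  have hmax : ∀ i, K i ≤ K 0 := by
    intro i; fin_cases i <;> simp [hKdef, hr1]
  have hT : ∀ i ∈ ({0, 1} : Finset (Fin 3)), K i = K 0 := by
    intro i hi
    simp only [mem_insert, mem_singleton] at hi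
    rcases hi with rfl | rfl
    · rfl
    · rw [hK0, hK1]
  have hsumT : ∑ i ∈ ({0, 1} : Finset (Fin 3)), K i = 2 := by
    rw [sum_pair (by decide : (0 : Fin 3) ≠ 1), hK0, hK1]
    norm_num
  have hsum : ∑ i, K i = 2 + r := by
    rw [Fin.sum_univ_three, hK0, hK1, hK2]
    norm_num
  have hκ : 0 < ∑ i ∈ ({0, 1} : Finset (Fin 3)), K i := by rw [hsumT]; norm_num
  have hCK : AnisotropicRotator.infraredConstant K = AnisotropicRotator.klsConstant r := by
    rw [hKdef, ← layeredCoupling_one_eq, AnisotropicRotator.infraredConstant_layeredCoupling one_ne_zero,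
      div_one, div_one]
  have habsK : ∀ j, ∑ i, |lam j * K i| = |lam j| * (2 + r) := by
    intro j
    simp only [Fin.sum_univ_three, hK0, hK1, hK2, abs_mul, abs_one, abs_of_pos hr0]
    ring
  refine heisAniso_thermal_neelLRO_of_klsCertificate (le_refl 3) hK hβ hmax {0, 1} hT hκ J t lam Wbar Tbar
    (fun j hj => by rw [hsum]; exact hpos j hj) hI (fun j hj => by rw [habsK j, hCK]; exact hC j hj)
    (fun e he1 he2 => ?_)
  rw [hsum] at he1 he2
  obtain ⟨j, hj, hc⟩ := hcert e he1 he2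
  refine ⟨j, hj, ?_⟩
  rw [hsum, hsumT, show (2 : ℝ) * 2 = 4 by norm_num]
  exact hc

/-- **Spin `½`** — the case Kennedy–Lieb–Shastry announce ([KLS1988JSP] p. 1020; p. 1023: "`e₀`
ranging from the Néel bound of `(2+r)/4`"): for the layered spin-`½` antiferromagnet `K = (1, 1, r)`,
`0 < r ≤ 1`, at inverse temperature `β > 0`, Néel long-range order on the even tori `(ℤ/(2k+2)ℤ)³`
follows from certified `W̄ⱼ > 𝓘^{(1,1,r)}_{tⱼ,λⱼ(1,1,r)}`, `T̄ⱼ > ({tⱼ}₊ + |λⱼ|(2+r))·C(r)` and a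
real-arithmetic certificate `δ(tⱼ - λⱼ(2+r)) ≤ tⱼ/4 - λⱼe - (e/4)^{1/2}W̄ⱼ - T̄ⱼ/(2β)` on the energy
window `(2+r)/12 - log 2/(3β) ≤ e ≤ (2+r)/4` (`e = e₀/3` in KLS's normalisation; at `T = 0` the
window is `[(2+r)/12, (2+r)/4]`, the entropy term `log 2/(3β)` is Dyson–Lieb–Simon's).
[cite: KLS1988JSP, p. 1020, eqs. (5)-(9), p. 1023] [cite: DLS1978, Thms. 5.1, 6.2, §6] [cite: FILS1978, eq. (4.7)] -/
theorem layeredHeis_neelLRO_thermal_spinHalf_of_certificate {r : ℝ} (hr0 : 0 < r) (hr1 : r ≤ 1)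
    {β : ℝ} (hβ : 0 < β) {ι : Type*} (J : Finset ι) (t lam Wbar Tbar : ι → ℝ)
    (hpos : ∀ j ∈ J, 0 < t j - lam j * (2 + r))
    (hI : ∀ j ∈ J,
      heisAnisoKlsIntegral ![(1 : ℝ), 1, r] (t j) (fun i => lam j * ![(1 : ℝ), 1, r] i) < Wbar j)
    (hC : ∀ j ∈ J, (max (t j) 0 + |lam j| * (2 + r)) * AnisotropicRotator.klsConstant r < Tbar j)
    {δ : ℝ}
    (hcert : ∀ e : ℝ, (2 + r) / 12 - Real.log 2 / (3 * β) ≤ e → e ≤ (2 + r) / 4 →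
      ∃ j ∈ J, δ * (t j - lam j * (2 + r)) ≤
        t j / 4 - lam j * e - Real.sqrt (e / 4) * Wbar j - 1 / (2 * β) * Tbar j) :
    3 * δ ≤ liminf (fun k : ℕ =>
      (∑ x : TorusSite 3 (2 * k + 2), ∑ y : TorusSite 3 (2 * k + 2),
        (-1 : ℝ) ^ (∑ i, (x i).val) * (-1) ^ (∑ i, (y i).val) *
          ∑ α : Fin 3, gibbsSpinCorr β (heisAnisoTorus (2 * k + 2) 1 ![(1 : ℝ), 1, r]) α x y) /
        ((2 * k + 2 : ℕ) : ℝ) ^ (2 * 3)) atTop := by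
  refine layeredHeis_neelLRO_thermal_of_certificate hr0 hr1 hβ J t lam Wbar Tbar hpos hI hC
    (fun e he1 he2 => ?_)
  simp only [Nat.cast_one] at he1 he2 ⊢
  rw [one_add_one_eq_two] at he1
  obtain ⟨j, hj, hc⟩ := hcert e (by linarith) (by linarith)
  exact ⟨j, hj, by linarith⟩

end KLSCertificate

end Literature.MathematicalPhysics.QuantumLattice
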